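import Summits.NavierStokesRegularity.FluidComputer.PalasekTowerRegisterGlobal
import Literature.Analysis.FluidPDE.LerayProfileCalculus
import Literature.Analysis.FluidPDE.TsaiMaximumPrinciple

/-!
# REGISTER v2.3′: the global anchor's bite at the first readout (first-hitting calculus)

Cell `ns-blowup`, seat `ns-blowup-ecbridge-4` (g0); companion of `PalasekTowerRegisterGlobal.lean`
(p411629: `Schedule.AnchorGlobal`, `Margins.routeG`, the items of record `EpisodeBaseG` /
`EpisodeInductionG` of the route `PalasekTowerBreakdown`, items stmt-NavierStokesRegularity-19179 /
-19178) and of the BC3 birth skeleton of `EpisodeBaseG` (stubs `host_preparation` = a globally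
anchored registered stage at level `0`, `first_episode` = heredity at level `0`, i.e.
`HeredityAt 0` of `PalasekTowerRegisterGlobalHeredity.lean`). LABEL: E–C typing (KERNEL lemmas about
the typed register). WHAT THIS IS NOT: not Navier–Stokes evidence — no stage, host, tower or instance
is constructed or claimed; the lemmas say what EVERY globally anchored stage must look like at its
first readout, they do not say that one exists.

## Why (route text «the ANCHOR needs a monotone first approach to Y₀»; refuter K37)

The GLOBAL ANCHOR `∀ t ∈ [0, τ₀), ∀ x, ‖u t x‖ < c₁ Y₀` together with the level-`0` floor
`∃ x₀ ∈ B̄(0, radius), c₁ Y₀ ≤ ‖u (τ₀) x₀‖` makes `τ₀` the FIRST HITTING TIME of the speed `c₁ Y₀`.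
For a classical (jointly smooth) solution this has kernel-checkable consequences, proved here for
every `routeG` stage at ANY level `k` of ANY schedule on ANY rates, at any viscosity `ν`:

* §1 `Stage.norm_τ_zero_le`: `‖u (τ₀) x‖ ≤ c₁ Y₀` for EVERY `x` (continuity from the left), so the
  level-`0` floor is met with EQUALITY (`norm_τ_zero_eq_of_floor`) and every floor point `x₀` is a
  GLOBAL spatial maximum of the speed at `τ₀` (`isMaxOn_norm_τ_zero`, `isLocalMax_normSq_τ_zero`);
* §2 first-order conditions: `⟪u, Du·v⟫ (τ₀, x₀) = 0` for every direction `v`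
  (`inner_fderiv_τ_zero_eq_zero`), in particular `⟪u, (u·∇)u⟫ (τ₀, x₀) = 0`
  (`inner_convect_τ_zero_eq_zero`), and the one-sided time derivative within the slab satisfies
  `0 ≤ ⟪u, ∂ₜu⟫ (τ₀, x₀)` (`inner_timeDeriv_τ_zero_nonneg`: the speed at `x₀` rises INTO `τ₀`);
* §3 with the momentum equation `∂ₜu + (u·∇)u = νΔu − ∇p + f` at `(τ₀, x₀)`:
  `⟪u, ∇p⟫ ≤ ν ⟪u, Δu⟫ + ⟪u, f⟫` (`inner_gradient_τ_zero_le`); the second-order condition at the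
  maximum (`Δ‖u‖² ≤ 0`, in-tree `laplacian_nonpos_of_isLocalMax`, with `Δ|U|² = 2⟪ΔU, U⟫ + 2|DU|²`,
  in-tree `laplacian_inner_self_eq`) gives `⟪u, Δu⟫ ≤ −|Du|²` (`inner_laplacian_τ_zero_le`), hence
  for `ν ≥ 0` the ANCHOR INEQUALITY
  `ν |Du (τ₀, x₀)|² + ⟪u, ∇p⟫ (τ₀, x₀) ≤ ⟪u, f (τ₀)⟫ (τ₀, x₀) ≤ c₁ c₄ Y₀²`
  (`anchor_inequality`, `anchor_inequality_push`; the last step is `push_small` at `t = τ₀`): at the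
  first readout the pressure gradient must accelerate the fluid at the floor point at least at the
  local viscous rate `ν |Du|²`, up to the window force budget. Packaged: `exists_firstHitting`.
* §4 `Stage.first_jump`: for a stage at level `≥ 1` of a pinned schedule on the wide-base rates the
  global speed maximum is exactly `c₁ Y₀` at `τ₀` and `≥ c₁ Y₁ ≥ 2 c₁ Y₀` somewhere in the ball at
  `τ₁ = τ₀ + c₅ log N₁ / A₀` (`TowerRates.wide_sep`, `Rigid.window_eq`), against a window force
  impulse `≤ (c₁ Y₁ − c₂ Y₀)/Λ` (`Pins.impulse`): the first episode must DOUBLE the global maximum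
  speed, whereas the later hand-overs start from the previous CEILING `c₂ Y_k`.

Consequence for the stubs (bookkeeping, not a verdict on the items): a level-`0` host is admissible
for `host_preparation` only if its floor point passes the anchor inequality, and the hypothesis class
of `first_episode` (`HeredityAt 0`) consists of such hosts only. E.g. an axisymmetric purely azimuthal
host `u = u_φ(r, z) e_φ` has `⟪u, ∇p⟫ = u_φ ∂_φ p / r = 0` for axisymmetric `p`, so it needs
`ν |Du(x₀)|² ≤ c₁ c₄ Y₀²` at its speed maximum — refuter K37's thin swirl torus (`|Du| ≍ V/δ`,
`δ = 10⁻⁶`) is not a level-`0` stage of the v2.3′ register. Nothing here decides `EpisodeBaseG`.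

References: S. Palasek, arXiv:2605.13827 §3.3, §4 [cite: Palasek2026ElementaryModel, §3.3];
D. Gilbarg, N. Trudinger, *Elliptic PDE of second order*, §3.1 (second-order condition at a maximum)
[cite: GilbargTrudinger2001, §3.1]; T.-P. Tsai, ARMA 143 (1998), proof of Lemma 3.1
(`−U·ΔU = |∇U|² − ½Δ|U|²`) [cite: Tsai1998, Lemma 3.1].
-/

noncomputable section

namespace Summit.NavierStokesRegularity.FluidComputer.PalasekTowerClayBridge

open Set MeasureTheory Filter Topology Function Real
open scoped ENNReal ContDiff NNReal InnerProductSpace RealInnerProductSpace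
open Laplacian
open Literature.Analysis.FluidPDE

namespace Stage

variable {ν : ℝ} {R : TowerRates} {S : Schedule R} {m : Margins R} {k : ℕ}

/-! ## §1 The first readout is a first hitting time: the floor is met with equality -/

/-- The first readout time lies in the slab `[0, τ k]` of every stage. [folklore] -/
theorem τ_zero_mem_Icc (_s : Stage ν R S m k) : S.τ 0 ∈ Icc 0 (S.τ k) :=
  ⟨(S.τ_pos 0).le, S.τ_mono (Nat.zero_le k)⟩

/-- Time lines `t ↦ u t x` of a stage are continuous within its slab (joint smoothness).
[folklore] -/
theorem continuousWithinAt_timeLine (s : Stage ν R S m k) {t : ℝ} (ht : t ∈ Icc 0 (S.τ k))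
    (x : EuclideanSpace ℝ (Fin 3)) :
    ContinuousWithinAt (fun t' => s.u t' x) (Icc 0 (S.τ k)) t :=
  (s.classical.smooth_velocity.differentiableWithinAt_time ht x).continuousWithinAt

/-- The time slice `u (τ 0)` of a stage is `C^∞`. [folklore] -/
theorem contDiff_u_τ_zero (s : Stage ν R S m k) : ContDiff ℝ ∞ (s.u (S.τ 0)) :=
  s.classical.contDiff_velocity s.τ_zero_mem_Icc

/-- **The global anchor survives to `τ₀` as a non-strict bound, EVERYWHERE**: for a globally anchored
stage, `‖u (τ₀) x‖ ≤ c₁ Y₀` for every point `x` of space (the speed is `< c₁ Y₀` on `[0, τ₀)` and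
each time line is continuous from the left at `τ₀`). [folklore] -/
theorem norm_τ_zero_le (s : Stage ν R S (Margins.routeG R) k) (x : EuclideanSpace ℝ (Fin 3)) :
    ‖s.u (S.τ 0) x‖ ≤ S.c₁ * R.Y 0 := by
  have hτ0 : 0 < S.τ 0 := S.τ_pos 0
  have hτ0k : S.τ 0 ≤ S.τ k := S.τ_mono (Nat.zero_le k)
  have hcont : ContinuousWithinAt (fun t => ‖s.u t x‖) (Ico 0 (S.τ 0)) (S.τ 0) :=
    ((s.continuousWithinAt_timeLine s.τ_zero_mem_Icc x).norm).mono
      fun t ht => ⟨ht.1, ht.2.le.trans hτ0k⟩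
  haveI hne : (𝓝[Ico 0 (S.τ 0)] (S.τ 0)).NeBot := by
    refine mem_closure_iff_nhdsWithin_neBot.1 ?_
    rw [closure_Ico hτ0.ne]
    exact right_mem_Icc.2 hτ0.le
  have hev : ∀ᶠ t in 𝓝[Ico 0 (S.τ 0)] (S.τ 0), ‖s.u t x‖ ≤ S.c₁ * R.Y 0 :=
    eventually_nhdsWithin_of_forall fun t ht => (s.routeG_anchorGlobal t ht x).le
  exact le_of_tendsto hcont hev

/-- **The level-`0` floor is met with equality**: at a floor point `x₀` (`c₁ Y₀ ≤ ‖u (τ₀) x₀‖`) the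
speed is exactly `c₁ Y₀`. [folklore] -/
theorem norm_τ_zero_eq_of_floor (s : Stage ν R S (Margins.routeG R) k)
    {x₀ : EuclideanSpace ℝ (Fin 3)} (hx₀ : S.c₁ * R.Y 0 ≤ ‖s.u (S.τ 0) x₀‖) :
    ‖s.u (S.τ 0) x₀‖ = S.c₁ * R.Y 0 :=
  le_antisymm (s.norm_τ_zero_le x₀) hx₀

/-- **The maximal speed at the first readout is exactly `c₁ Y₀`**, attained in the ball.
[folklore] -/
theorem exists_norm_τ_zero_eq (s : Stage ν R S (Margins.routeG R) k) :
    ∃ x₀, ‖x₀‖ ≤ S.radius ∧ ‖s.u (S.τ 0) x₀‖ = S.c₁ * R.Y 0 ∧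
      ∀ x, ‖s.u (S.τ 0) x‖ ≤ S.c₁ * R.Y 0 := by
  obtain ⟨x₀, hx₀, hfl⟩ := s.floor 0 (Nat.zero_le k)
  exact ⟨x₀, hx₀, s.norm_τ_zero_eq_of_floor hfl, s.norm_τ_zero_le⟩

/-- Every level-`0` floor point is a GLOBAL maximum of the speed at `τ₀`. [folklore] -/
theorem isMaxOn_norm_τ_zero (s : Stage ν R S (Margins.routeG R) k)
    {x₀ : EuclideanSpace ℝ (Fin 3)} (hx₀ : S.c₁ * R.Y 0 ≤ ‖s.u (S.τ 0) x₀‖) :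
    IsMaxOn (fun x => ‖s.u (S.τ 0) x‖) univ x₀ :=
  fun x _ => (s.norm_τ_zero_le x).trans hx₀

/-- … hence a local maximum of the squared speed. [folklore] -/
theorem isLocalMax_normSq_τ_zero (s : Stage ν R S (Margins.routeG R) k)
    {x₀ : EuclideanSpace ℝ (Fin 3)} (hx₀ : S.c₁ * R.Y 0 ≤ ‖s.u (S.τ 0) x₀‖) :
    IsLocalMax (fun x => ‖s.u (S.τ 0) x‖ ^ 2) x₀ :=
  Filter.Eventually.of_forall fun x =>
    pow_le_pow_left₀ (norm_nonneg _) ((s.norm_τ_zero_le x).trans hx₀) 2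

/-- … and of the speed written as `⟪u, u⟫`. [folklore] -/
theorem isLocalMax_inner_self_τ_zero (s : Stage ν R S (Margins.routeG R) k)
    {x₀ : EuclideanSpace ℝ (Fin 3)} (hx₀ : S.c₁ * R.Y 0 ≤ ‖s.u (S.τ 0) x₀‖) :
    IsLocalMax (fun x => ⟪s.u (S.τ 0) x, s.u (S.τ 0) x⟫) x₀ := by
  have h := s.isLocalMax_normSq_τ_zero hx₀
  simpa only [real_inner_self_eq_norm_sq] using h

/-! ## §2 First-order conditions at a floor point -/

/-- **Spatial first-order condition**: at a level-`0` floor point, `⟪u, Du·v⟫ (τ₀, x₀) = 0` for every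
direction `v` (the derivative of `‖u (τ₀, ·)‖²` vanishes at its maximum). [folklore] -/
theorem inner_fderiv_τ_zero_eq_zero (s : Stage ν R S (Margins.routeG R) k)
    {x₀ : EuclideanSpace ℝ (Fin 3)} (hx₀ : S.c₁ * R.Y 0 ≤ ‖s.u (S.τ 0) x₀‖)
    (v : EuclideanSpace ℝ (Fin 3)) :
    ⟪s.u (S.τ 0) x₀, fderiv ℝ (s.u (S.τ 0)) x₀ v⟫ = 0 := by
  set U := s.u (S.τ 0) with hU
  have hC1 : ContDiff ℝ 1 U := s.contDiff_u_τ_zero.of_le (by norm_cast)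
  have hd : HasFDerivAt U (fderiv ℝ U x₀) x₀ := (hC1.differentiable one_ne_zero x₀).hasFDerivAt
  have hsq := hd.norm_sq
  have h0 := (s.isLocalMax_normSq_τ_zero hx₀).hasFDerivAt_eq_zero hsq
  rw [two_nsmul] at h0
  have h2 := congrArg (fun L : EuclideanSpace ℝ (Fin 3) →L[ℝ] ℝ => L v) h0
  simp only [add_apply, ContinuousLinearMap.comp_apply, innerSL_apply_apply,
    zero_apply] at h2
  linarith

/-- **No self-advection of speed at the floor point**: `⟪u, (u·∇)u⟫ (τ₀, x₀) = 0`. [folklore] -/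
theorem inner_convect_τ_zero_eq_zero (s : Stage ν R S (Margins.routeG R) k)
    {x₀ : EuclideanSpace ℝ (Fin 3)} (hx₀ : S.c₁ * R.Y 0 ≤ ‖s.u (S.τ 0) x₀‖) :
    ⟪s.u (S.τ 0) x₀, convect (s.u (S.τ 0)) (s.u (S.τ 0)) x₀⟫ = 0 := by
  rw [convect_apply]
  exact s.inner_fderiv_τ_zero_eq_zero hx₀ _

/-- **Temporal first-order condition (monotone first approach)**: at a level-`0` floor point the
one-sided time derivative within the slab satisfies `0 ≤ ⟪u, ∂ₜu⟫ (τ₀, x₀)` — the squared speed at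
`x₀` is `< (c₁ Y₀)²` before `τ₀` and `= (c₁ Y₀)²` at `τ₀`, so its derivative within `[0, τ₀]` at
`τ₀` is nonnegative (local maximum on a set whose positive tangent cone at `τ₀` contains `−1`).
[folklore] -/
theorem inner_timeDeriv_τ_zero_nonneg (s : Stage ν R S (Margins.routeG R) k)
    {x₀ : EuclideanSpace ℝ (Fin 3)} (hx₀ : S.c₁ * R.Y 0 ≤ ‖s.u (S.τ 0) x₀‖) :
    0 ≤ ⟪s.u (S.τ 0) x₀, timeDerivWithin (Icc 0 (S.τ k)) s.u (S.τ 0) x₀⟫ := by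
  have hτ0 : 0 < S.τ 0 := S.τ_pos 0
  have hτ0k : S.τ 0 ≤ S.τ k := S.τ_mono (Nat.zero_le k)
  set D := timeDerivWithin (Icc 0 (S.τ k)) s.u (S.τ 0) x₀ with hD
  have hline : HasDerivWithinAt (fun t => s.u t x₀) D (Icc 0 (S.τ k)) (S.τ 0) := by
    have h := (s.classical.smooth_velocity.differentiableWithinAt_time s.τ_zero_mem_Icc x₀).hasDerivWithinAt
    simpa only [hD, timeDerivWithin_apply] using h
  have hsq : HasDerivWithinAt (fun t => ‖s.u t x₀‖ ^ 2) (2 * ⟪s.u (S.τ 0) x₀, D⟫)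
      (Icc 0 (S.τ 0)) (S.τ 0) :=
    hline.norm_sq.mono (Icc_subset_Icc_right hτ0k)
  have heq : ‖s.u (S.τ 0) x₀‖ = S.c₁ * R.Y 0 := s.norm_τ_zero_eq_of_floor hx₀
  have hmax : IsLocalMaxOn (fun t => ‖s.u t x₀‖ ^ 2) (Icc 0 (S.τ 0)) (S.τ 0) := by
    refine eventually_nhdsWithin_of_forall fun t ht => ?_
    show ‖s.u t x₀‖ ^ 2 ≤ ‖s.u (S.τ 0) x₀‖ ^ 2
    rcases ht.2.eq_or_lt with h | h
    · rw [h]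
    · have hlt : ‖s.u t x₀‖ < S.c₁ * R.Y 0 := s.routeG_anchorGlobal t ⟨ht.1, h⟩ x₀
      rw [heq]
      exact pow_le_pow_left₀ (norm_nonneg _) hlt.le 2
  have hy : (0 : ℝ) - S.τ 0 ∈ posTangentConeAt (Icc 0 (S.τ 0)) (S.τ 0) := by
    apply sub_mem_posTangentConeAt_of_segment_subset
    rw [segment_symm, segment_eq_Icc hτ0.le]
  have hle := hmax.hasFDerivWithinAt_nonpos hsq.hasFDerivWithinAt hy
  simp only [ContinuousLinearMap.toSpanSingleton_apply, smul_eq_mul] at hle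
  by_contra hneg
  have hneg' : ⟪s.u (S.τ 0) x₀, D⟫ < 0 := lt_of_not_ge hneg
  have : 0 < (0 - S.τ 0) * (2 * ⟪s.u (S.τ 0) x₀, D⟫) :=
    mul_pos_of_neg_of_neg (by linarith) (by linarith)
  linarith

/-! ## §3 The momentum equation at the floor point: the anchor inequality -/

/-- **Pressure must drive the maximum**: at a level-`0` floor point of a globally anchored stage,
`⟪u, ∇p⟫ ≤ ν ⟪u, Δu⟫ + ⟪u, f⟫` at `(τ₀, x₀)` (momentum equation, `⟪u, ∂ₜu⟫ ≥ 0`, `⟪u, (u·∇)u⟫ = 0`).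
[cite: Palasek2026ElementaryModel, §3.3] -/
theorem inner_gradient_τ_zero_le (s : Stage ν R S (Margins.routeG R) k)
    {x₀ : EuclideanSpace ℝ (Fin 3)} (hx₀ : S.c₁ * R.Y 0 ≤ ‖s.u (S.τ 0) x₀‖) :
    ⟪s.u (S.τ 0) x₀, gradient (s.p (S.τ 0)) x₀⟫ ≤
      ν * ⟪s.u (S.τ 0) x₀, Δ (s.u (S.τ 0)) x₀⟫ + ⟪s.u (S.τ 0) x₀, S.f (S.τ 0) x₀⟫ := by
  have hmom := s.classical.momentum (S.τ 0) s.τ_zero_mem_Icc x₀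
  have hD : timeDerivWithin (Icc 0 (S.τ k)) s.u (S.τ 0) x₀ =
      ν • Δ (s.u (S.τ 0)) x₀ - gradient (s.p (S.τ 0)) x₀ + S.f (S.τ 0) x₀ -
        convect (s.u (S.τ 0)) (s.u (S.τ 0)) x₀ := by
    rw [← hmom]; abel
  have h1 := s.inner_timeDeriv_τ_zero_nonneg hx₀
  rw [hD, inner_sub_right, inner_add_right, inner_sub_right, real_inner_smul_right,
    s.inner_convect_τ_zero_eq_zero hx₀] at h1
  linarith

/-- **Second-order condition at the maximum**: `⟪u, Δu⟫ (τ₀, x₀) ≤ −|Du (τ₀, x₀)|²` (Frobenius norm),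
from `Δ‖u‖² ≤ 0` at the maximum and `Δ|U|² = 2⟪ΔU, U⟫ + 2|DU|²`.
[cite: GilbargTrudinger2001, §3.1] [cite: Tsai1998, Lemma 3.1] -/
theorem inner_laplacian_τ_zero_le (s : Stage ν R S (Margins.routeG R) k)
    {x₀ : EuclideanSpace ℝ (Fin 3)} (hx₀ : S.c₁ * R.Y 0 ≤ ‖s.u (S.τ 0) x₀‖) :
    ⟪s.u (S.τ 0) x₀, Δ (s.u (S.τ 0)) x₀⟫ ≤ - frobeniusNormSq (fderiv ℝ (s.u (S.τ 0)) x₀) := by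
  set U := s.u (S.τ 0) with hU
  have hC2 : ContDiff ℝ 2 U := s.contDiff_u_τ_zero.of_le (by norm_cast)
  have hΔ : (Δ fun y => ⟪U y, U y⟫) x₀ ≤ 0 :=
    laplacian_nonpos_of_isLocalMax (hC2.inner ℝ hC2) (s.isLocalMax_inner_self_τ_zero hx₀)
  rw [laplacian_inner_self_eq hC2 x₀, real_inner_comm] at hΔ
  linarith

/-- **THE ANCHOR INEQUALITY.** For `ν ≥ 0`, at every level-`0` floor point of a globally anchored
registered stage, `ν |Du|² + ⟪u, ∇p⟫ ≤ ⟪u, f⟫` at `(τ₀, x₀)`: the pressure gradient accelerates the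
fluid at the first-hitting point at least at the local viscous dissipation rate, up to the force.
[cite: Palasek2026ElementaryModel, §3.3] -/
theorem anchor_inequality (s : Stage ν R S (Margins.routeG R) k) (hν : 0 ≤ ν)
    {x₀ : EuclideanSpace ℝ (Fin 3)} (hx₀ : S.c₁ * R.Y 0 ≤ ‖s.u (S.τ 0) x₀‖) :
    ν * frobeniusNormSq (fderiv ℝ (s.u (S.τ 0)) x₀) + ⟪s.u (S.τ 0) x₀, gradient (s.p (S.τ 0)) x₀⟫ ≤
      ⟪s.u (S.τ 0) x₀, S.f (S.τ 0) x₀⟫ := by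
  have h1 := s.inner_gradient_τ_zero_le hx₀
  have h2 := s.inner_laplacian_τ_zero_le hx₀
  have h3 : ν * ⟪s.u (S.τ 0) x₀, Δ (s.u (S.τ 0)) x₀⟫ ≤
      ν * (- frobeniusNormSq (fderiv ℝ (s.u (S.τ 0)) x₀)) :=
    mul_le_mul_of_nonneg_left h2 hν
  linarith

/-- The window force at the first readout does work at rate at most `c₁ c₄ Y₀²` on the floor point
(`push_small` at `t = τ₀ ∈ [τ₀, τ₁]`, Cauchy–Schwarz, `‖u (τ₀) x₀‖ = c₁ Y₀`). [folklore] -/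
theorem inner_force_τ_zero_le (s : Stage ν R S (Margins.routeG R) k)
    {x₀ : EuclideanSpace ℝ (Fin 3)} (hx₀ : S.c₁ * R.Y 0 ≤ ‖s.u (S.τ 0) x₀‖) :
    ⟪s.u (S.τ 0) x₀, S.f (S.τ 0) x₀⟫ ≤ S.c₁ * S.c₄ * R.Y 0 ^ 2 := by
  have hf : ‖S.f (S.τ 0) x₀‖ ≤ S.c₄ * R.Y 0 :=
    S.push_small 0 (S.τ 0) ⟨le_rfl, (S.τ_lt_succ 0).le⟩ x₀
  have heq : ‖s.u (S.τ 0) x₀‖ = S.c₁ * R.Y 0 := s.norm_τ_zero_eq_of_floor hx₀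
  have hY : 0 < R.Y 0 := Real.rpow_pos_of_pos (R.N_pos 0) _
  have hc₁ : 0 < S.c₁ := S.c₁_pos
  calc ⟪s.u (S.τ 0) x₀, S.f (S.τ 0) x₀⟫ ≤ ‖s.u (S.τ 0) x₀‖ * ‖S.f (S.τ 0) x₀‖ :=
        real_inner_le_norm _ _
    _ ≤ (S.c₁ * R.Y 0) * (S.c₄ * R.Y 0) := by
        rw [heq]
        exact mul_le_mul_of_nonneg_left hf (mul_pos hc₁ hY).le
    _ = S.c₁ * S.c₄ * R.Y 0 ^ 2 := by ring

/-- **The anchor inequality in registered numbers**: `ν |Du (τ₀, x₀)|² + ⟪u, ∇p⟫ (τ₀, x₀) ≤ c₁ c₄ Y₀²`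
at every level-`0` floor point, for `ν ≥ 0`. [cite: Palasek2026ElementaryModel, §3.3] -/
theorem anchor_inequality_push (s : Stage ν R S (Margins.routeG R) k) (hν : 0 ≤ ν)
    {x₀ : EuclideanSpace ℝ (Fin 3)} (hx₀ : S.c₁ * R.Y 0 ≤ ‖s.u (S.τ 0) x₀‖) :
    ν * frobeniusNormSq (fderiv ℝ (s.u (S.τ 0)) x₀) + ⟪s.u (S.τ 0) x₀, gradient (s.p (S.τ 0)) x₀⟫ ≤
      S.c₁ * S.c₄ * R.Y 0 ^ 2 :=
  (s.anchor_inequality hν hx₀).trans (s.inner_force_τ_zero_le hx₀)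

/-- **What every globally anchored registered stage looks like at its first readout** (packaged):
a point `x₀` of the ball where the speed equals `c₁ Y₀` and is globally maximal, where
`⟪u, Du·v⟫ = 0` for all `v`, where the speed rises into `τ₀` (`0 ≤ ⟪u, ∂ₜu⟫` within the slab), and
where the anchor inequality `ν |Du|² + ⟪u, ∇p⟫ ≤ ⟪u, f⟫ ≤ c₁ c₄ Y₀²` holds (`ν ≥ 0`). A necessary
condition on the hosts of `host_preparation` and on the hypothesis class of `first_episode`; no
instance is claimed. [cite: Palasek2026ElementaryModel, §3.3] -/
theorem exists_firstHitting (s : Stage ν R S (Margins.routeG R) k) (hν : 0 ≤ ν) :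
    ∃ x₀ : EuclideanSpace ℝ (Fin 3), ‖x₀‖ ≤ S.radius ∧
      ‖s.u (S.τ 0) x₀‖ = S.c₁ * R.Y 0 ∧
      (∀ x, ‖s.u (S.τ 0) x‖ ≤ S.c₁ * R.Y 0) ∧
      (∀ v, ⟪s.u (S.τ 0) x₀, fderiv ℝ (s.u (S.τ 0)) x₀ v⟫ = 0) ∧
      0 ≤ ⟪s.u (S.τ 0) x₀, timeDerivWithin (Icc 0 (S.τ k)) s.u (S.τ 0) x₀⟫ ∧
      ν * frobeniusNormSq (fderiv ℝ (s.u (S.τ 0)) x₀) +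
          ⟪s.u (S.τ 0) x₀, gradient (s.p (S.τ 0)) x₀⟫ ≤ ⟪s.u (S.τ 0) x₀, S.f (S.τ 0) x₀⟫ ∧
      ν * frobeniusNormSq (fderiv ℝ (s.u (S.τ 0)) x₀) +
          ⟪s.u (S.τ 0) x₀, gradient (s.p (S.τ 0)) x₀⟫ ≤ S.c₁ * S.c₄ * R.Y 0 ^ 2 := by
  obtain ⟨x₀, hx₀, hfl⟩ := s.floor 0 (Nat.zero_le k)
  exact ⟨x₀, hx₀, s.norm_τ_zero_eq_of_floor hfl, s.norm_τ_zero_le,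
    s.inner_fderiv_τ_zero_eq_zero hfl, s.inner_timeDeriv_τ_zero_nonneg hfl,
    s.anchor_inequality hν hfl, s.anchor_inequality_push hν hfl⟩

/-! ## §4 The first jump (wide-base rates, pinned schedule, level `≥ 1`) -/

/-- **The first episode must double the global maximum speed.** For a globally anchored registered
stage at a level `≥ 1` of a pinned schedule on the wide-base rates: at `τ₀` the speed is `≤ c₁ Y₀`
EVERYWHERE (not merely `≤ c₂ Y₀`), at `τ₁` it is `≥ c₁ Y₁` somewhere in the ball, `2 c₁ Y₀ ≤ c₁ Y₁`
(`TowerRates.wide_sep`), the window is the rigid one `τ₁ − τ₀ = c₅ log N₁ / A₀`, and the admissible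
force impulse on it is at most `(c₁ Y₁ − c₂ Y₀)/Λ` (`Pins.impulse`). [cite: Palasek2026ElementaryModel, §3.3] -/
theorem first_jump {S : Schedule TowerRates.wide} {Λ θ : ℝ} {k : ℕ} (hP : S.Pins Λ θ)
    (s : Stage ν TowerRates.wide S (Margins.routeG TowerRates.wide) (k + 1)) :
    (∀ y, ‖s.u (S.τ 0) y‖ ≤ S.c₁ * TowerRates.wide.Y 0) ∧
      (∃ x, ‖x‖ ≤ S.radius ∧ S.c₁ * TowerRates.wide.Y 1 ≤ ‖s.u (S.τ 1) x‖) ∧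
      2 * (S.c₁ * TowerRates.wide.Y 0) ≤ S.c₁ * TowerRates.wide.Y 1 ∧
      S.τ 1 - S.τ 0 = S.c₅ * Real.log (TowerRates.wide.N 1) / TowerRates.wide.A 0 ∧
      Λ * (S.c₄ * TowerRates.wide.Y 0) * (S.τ 1 - S.τ 0) ≤
        S.c₁ * TowerRates.wide.Y 1 - S.c₂ * TowerRates.wide.Y 0 := by
  refine ⟨s.norm_τ_zero_le, s.floor 1 (by omega), ?_, ?_, hP.impulse 0⟩
  · have h := TowerRates.wide_sep 0
    have hc₁ : 0 < S.c₁ := S.c₁_pos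
    nlinarith
  · have h := s.routeG_rigid.window_eq 0
    linarith

end Stage

end Summit.NavierStokesRegularity.FluidComputer.PalasekTowerClayBridge

end
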